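import Summits.CriticalPhenomena.Ising3DConformalLimit.Theses.CanonicalBranchRefutation
import Summits.CriticalPhenomena.Ising3DConformalLimit.Theorems.PrimaryAtInfinityTwoPointPowerLawEta
import Literature.Probability.LatticeModels.PointwiseScalingLimitEtaExists
import Literature.MathematicalPhysics.QuantumFieldTheory.CFTAxioms
import HarnessLib

/-!
# The branch hypothesis `InfraredExponentZero` against the sub-problem: the route's deliverable,
# unconditionally (crux stmt-CriticalPhenomena-15521, route `CanonicalBranchRefutation`, lead c3)

THEOREM-ONLY support file for the crux `CanonicalBranchRefutation.InfraredExponentZero`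
(`:= HasIsingExponentEta 3 0`, the logarithmic `η(3) = 0`; item stmt-CriticalPhenomena-15521, the
route's BRANCH HYPOTHESIS, expected FALSE). The route `CanonicalBranchRefutation` was opened to bank
the NECESSARY CONDITION `Ising3DConformalLimit ⇒ η_log(3) ≠ 0` through
`closes : CanonicalDimensionIsWick → InfraredExponentZero → IsingLimitHeritage → ¬Ising3DConformalLimit`.
This file records that the deliverable is ALREADY a theorem of the tree, with the two other cruxes
(`CanonicalDimensionIsWick`, stmt-15520; `IsingLimitHeritage`, stmt-15523) NOT needed:

* `not_infraredExponentZero_of_ising3DConformalLimit : Ising3DConformalLimit → ¬ InfraredExponentZero`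
  — kill criterion (c) of the route as a theorem: the sub-problem statement refutes the crux; its
  contrapositive `fun hZ h => not_infraredExponentZero_of_ising3DConformalLimit h hZ :
  InfraredExponentZero → ¬ Ising3DConformalLimit` is the route's conclusion from the bet ALONE, i.e.
  `closes` with its first and third hypotheses dropped (not declared separately here);
* `exists_pos_isingEta_of_ising3DConformalLimit` — "every proof of the summit conjunct proves
  `η(3) > 0` on the way": `Ising3DConformalLimit → ∃ η, 0 < η ∧ η ≤ 1/2 ∧ HasIsingExponentEta 3 η`;
* `not_hasNontrivialU4_of_infraredExponentZero` — on the canonical branch EVERY non-degenerate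
  pointwise scaling limit of the critical Ising₃ correlators is Gaussian at order four (`U₄ ≡ 0` in the
  sense `¬ HasNontrivialU4`): the thesis "(Z) ∧ (W) ⇒ ¬(iii)" with the lever (W) discharged;
* `infraredExponentZero_or_twoPointPowerLawEta` — unconditionally, the bet of this route OR the crux
  `PrimaryAtInfinity.TwoPointPowerLawEta` (item stmt-CriticalPhenomena-5354) holds: the two routes bet
  on complementary branches, and given the conjunct exactly the second survives
  (`twoPointPowerLawEta_and_not_infraredExponentZero_of_ising3DConformalLimit`);
* `not_infraredExponentZero_of_critIsing3DExponentValues` — "expected FALSE", typed: the standard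
  conjecture crit-ising.S23 (`CritIsing3DExponentValues`, bootstrap island `η ∈ [0.0362958, 0.0362998]`)
  refutes the crux.

Mechanism (all LANDED, axioms `propext`, `Classical.choice`, `Quot.sound`): the structure theorem
`PrimaryAtInfinityTwoPointPowerLawEta.twoPoint_structure_of_limit` — every non-degenerate pointwise
limit `(ρ, S)` of `criticalCorr 3` has a dimension `Δ ∈ [1/2, 3/4]` with `HasIsingExponentEta 3 (2Δ-1)`
and `HasNontrivialU4 S → 1/2 < Δ` (edge Gaussianity at `Δ = 1/2`: nine-mirror reflection positivity,
exterior harmonicity = OS null vector of the kernel `‖θa-b‖⁻¹`, analyticity off a finite set,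
Bôcher + GKS/Lebowitz + Liouville — `NullLaplacianEdgeGaussianity.half_lt_delta_of_hasNontrivialU4`,
i.e. the potential-theoretic lever of THIS route, proved on route GaussianScaleMixture) — together
with uniqueness of the logarithmic exponent along `cofinite` (`HasIsingExponentEta.unique`).

Consequence for the ledger (planner): route CanonicalBranchRefutation has SERVED — its deliverable is
banked here without stmt-15520 / stmt-15523; the crux stmt-15521 stays the open problem `η(3) = 0`
(expected false; refuted the day `AnomalousForcesInteraction.EtaPositive` or the conjunct itself lands).

Sources: Duminil-Copin, ICM 2022, §4.2.1 and §8 [DuminilCopinICM2022]; Duminil-Copin–Panis, CMP 406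
(2025), Thm. 1.5 [DuminilCopinPanis2025LowerBounds]; Kos–Poland–Simmons-Duffin–Vichi 2016, §1
[KosPolandSimmonsDuffinVichi2016]; tree: `twoPoint_structure_of_limit`, `twoPointPowerLawEta_of_conjunct`,
`etaPos_of_twoPointPowerLawEta`, `twoPointPowerLawEta_of_not_etaZero`,
`HasPointwiseScalingLimit.exists_isingEta`, `CritIsing3DExponentValues.exists_hasIsingExponentEta`.
-/

noncomputable section

namespace Summit.CriticalPhenomena.Ising3DConformalLimit.Theorems

open Literature.Probability.LatticeModels
open Summit.CriticalPhenomena.Ising3DConformalLimit.Theses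
open Summit.CriticalPhenomena.Ising3DConformalLimit.Theorems.PrimaryAtInfinityTwoPointPowerLawEta
  (twoPoint_structure_of_limit twoPointPowerLawEta_of_conjunct etaPos_of_twoPointPowerLawEta
    twoPointPowerLawEta_of_not_etaZero)

/-- **Kill criterion (c) as a theorem: the conjunct refutes the bet.** `Ising3DConformalLimit` (one
non-degenerate, Möbius-covariant, non-Gaussian pointwise scaling limit of the critical Ising₃ correlators)
implies `¬ InfraredExponentZero`: the conjunct gives `TwoPointPowerLawEta`
(`twoPointPowerLawEta_of_conjunct`), which together with the conjunct's own limit forces every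
logarithmic exponent of `⟨σ₀σ_x⟩_{β_c(3)}` to be positive (`etaPos_of_twoPointPowerLawEta`) — in
particular `η = 0` is impossible. [cite: DuminilCopinICM2022, §4.2.1 and §8.4] -/
theorem not_infraredExponentZero_of_ising3DConformalLimit :
    Ising3DConformalLimit →
      ¬ Summit.CriticalPhenomena.Ising3DConformalLimit.Theses.CanonicalBranchRefutation.InfraredExponentZero := by
  intro h h0
  obtain ⟨ρ, Δ, S, hρ, hΔ, hlim, hnd, hM, hU4⟩ := h
  have h5354 : PrimaryAtInfinity.TwoPointPowerLawEta :=
    twoPointPowerLawEta_of_conjunct ⟨ρ, Δ, S, hρ, hΔ, hlim, hnd, hM, hU4⟩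
  have hpos : (0 : ℝ) < 0 :=
    etaPos_of_twoPointPowerLawEta h5354 hρ hlim hnd (show HasIsingExponentEta 3 0 from h0)
  exact lt_irrefl 0 hpos

/-- **"Every proof of the conjunct proves `η(3) > 0` on the way."** `Ising3DConformalLimit` forces the
anomalous dimension of the critical Ising model on `ℤ³` to EXIST and to lie in `(0, 1/2]`: existence and
`η ≤ 1/2` from any non-degenerate pointwise limit (`HasPointwiseScalingLimit.exists_isingEta`,
Duminil-Copin–Panis 2025 Thm. 1.5), strict positivity from `not_infraredExponentZero_of_ising3DConformalLimit`.
[cite: DuminilCopinPanis2025LowerBounds, Theorem 1.5] -/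
theorem exists_pos_isingEta_of_ising3DConformalLimit (h : Ising3DConformalLimit) :
    ∃ η : ℝ, 0 < η ∧ η ≤ 1 / 2 ∧ HasIsingExponentEta 3 η := by
  have hne := not_infraredExponentZero_of_ising3DConformalLimit h
  obtain ⟨ρ, Δ, S, hρ, -, hlim, hnd, -, -⟩ := h
  obtain ⟨η, hη, hexp⟩ := hlim.exists_isingEta hρ hnd
  rcases eq_or_lt_of_le hη.1 with h0 | hpos
  · exact absurd (show CanonicalBranchRefutation.InfraredExponentZero by
      unfold CanonicalBranchRefutation.InfraredExponentZero; rwa [h0]) hne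
  · exact ⟨η, hpos, hη.2, hexp⟩

/-- **On the canonical branch every limit is Gaussian at order four** (the route's thesis
"(Z) ∧ (W) ⇒ ¬(iii)" with the lever (W) a theorem): if `η_log(3) = 0` then every non-degenerate
pointwise scaling limit `(ρ, S)` of `criticalCorr 3` (`ρ > 0` on `(0,1]`) has `U₄ ≡ 0` on non-coincident
quadruples. By `twoPoint_structure_of_limit` the limit carries a dimension `Δ` with
`HasIsingExponentEta 3 (2Δ - 1)` and `HasNontrivialU4 S → 1/2 < Δ`; uniqueness of the logarithmic
exponent pins `2Δ - 1 = 0`. [cite: DuminilCopinICM2022, §8.1] -/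
theorem not_hasNontrivialU4_of_infraredExponentZero
    (hZ : CanonicalBranchRefutation.InfraredExponentZero) {ρ : ℝ → ℝ} {S : CorrFamily 3}
    (hρ : ∀ δ ∈ Set.Ioc (0:ℝ) 1, 0 < ρ δ) (hlim : HasPointwiseScalingLimit (criticalCorr 3) ρ S)
    (hnd : IsNondegenerateTwoPoint S) : ¬ HasNontrivialU4 S := by
  intro hU4
  obtain ⟨Δ, -, hη, -, hgt, -⟩ := twoPoint_structure_of_limit hρ hlim hnd
  have hΔ : 1 / 2 < Δ := hgt hU4
  have huniq : 2 * Δ - 1 = 0 := hη.unique (show HasIsingExponentEta 3 0 from hZ)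
  linarith

/-- **Complementary bets.** Unconditionally, `InfraredExponentZero ∨ PrimaryAtInfinity.TwoPointPowerLawEta`:
if the logarithmic exponent is not exactly `1`, a non-degenerate limit with `Δ = 1/2` is impossible
(`twoPointPowerLawEta_of_not_etaZero`). Routes CanonicalBranchRefutation (item stmt-15521) and
PrimaryAtInfinity (item stmt-5354) bet on complementary branches. [cite: DuminilCopinICM2022, §4.2.1] -/
theorem infraredExponentZero_or_twoPointPowerLawEta :
    CanonicalBranchRefutation.InfraredExponentZero ∨ PrimaryAtInfinity.TwoPointPowerLawEta := by
  by_cases h0 : CanonicalBranchRefutation.InfraredExponentZero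
  · exact Or.inl h0
  · exact Or.inr (twoPointPowerLawEta_of_not_etaZero h0)

/-- **Given the conjunct, exactly the second branch survives**: `Ising3DConformalLimit` gives
`TwoPointPowerLawEta ∧ ¬ InfraredExponentZero`. [cite: DuminilCopinICM2022, §8.4] -/
theorem twoPointPowerLawEta_and_not_infraredExponentZero_of_ising3DConformalLimit
    (h : Ising3DConformalLimit) :
    PrimaryAtInfinity.TwoPointPowerLawEta ∧ ¬ CanonicalBranchRefutation.InfraredExponentZero :=
  ⟨twoPointPowerLawEta_of_conjunct h, not_infraredExponentZero_of_ising3DConformalLimit h⟩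

/-- **"Expected FALSE", typed.** The standard conjecture crit-ising.S23
(`Literature.MathematicalPhysics.QuantumFieldTheory.CritIsing3DExponentValues`: the critical Ising₃
scaling limit is the bootstrap-island CFT, so that `η = 2Δ_σ - 1 ∈ [0.0362958, 0.0362998]`,
Kos–Poland–Simmons-Duffin–Vichi 2016) refutes the branch hypothesis, by uniqueness of the logarithmic
exponent. [cite: KosPolandSimmonsDuffinVichi2016, §1] -/
theorem not_infraredExponentZero_of_critIsing3DExponentValues
    (h23 : Literature.MathematicalPhysics.QuantumFieldTheory.CritIsing3DExponentValues) :
    ¬ CanonicalBranchRefutation.InfraredExponentZero := by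
  intro h0
  obtain ⟨η, hη, hexp⟩ := h23.exists_hasIsingExponentEta
  have huniq : η = 0 := hexp.unique (show HasIsingExponentEta 3 0 from h0)
  have hlo : (0.0362958 : ℝ) ≤ η := hη.1
  rw [huniq] at hlo
  norm_num at hlo

end Summit.CriticalPhenomena.Ising3DConformalLimit.Theorems

end
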